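import Summits.QuantumAdvantage.QuantumAdvantage.Theorems.MultiRingGridCycles

/-!
# Many-ring grid bridge, part 2/3: the packing (a row of disjoint squares) and pattern flattening

Module 2 of the split of `MultiRingBridge` (lens-5 «BridgeDial» node, decomp-qadv cell gen 6, tree twin sha256 d782ca8a…; split into three ≤ 400-line modules for landing by the census seat decomp-qadv-census-1 g5 — content VERBATIM, only module boundaries, headers and five helper docstrings added).

`GridCycles.rowSquares` — for `t ≥ 2` and `J(2t+1) ≤ N`, the boundaries of the `J` squares of side `2t` with top-left corners
`(0, j(2t+1))` are `J` disjoint grid cycles of length `8t`; `flat` / `unflat` — row-major (un)flattening of joint patterns.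
-/

noncomputable section

open Finset Polynomial
open Literature.Computability.Cryptography Literature.Computability.Complexity
open Literature.Computability.QuantumComplexity Literature.Computability.MetaComplexity
open Literature.Computability.QuantumComplexity.RingHLF

-- the sub-problem namespace `Summit.QuantumAdvantage.QuantumAdvantage` repeats the summit name by design (D-0017)
set_option linter.dupNamespace false

namespace Summit.QuantumAdvantage.QuantumAdvantage.Theorems

open Summit.QuantumAdvantage.AdviceFreeQNC0

/-! ## 2. The packing: a row of disjoint squares -/

namespace RowSquares

/-- The square of half-side `t ≥ 2` with top-left corner `(0, c₁)`, `c₁ + 2t < N`. -/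
def squareAt {N : ℕ} (t c₁ : ℕ) (ht : 2 ≤ t) (hr : 2 * t < N) (hc : c₁ + 2 * t < N) : RectData N where
  r₁ := 0
  c₁ := c₁
  hw := t
  hh := t
  a := 1
  b := 1
  c := 1
  a_pos := Nat.one_pos
  a_lt := ht
  b_pos := Nat.one_pos
  b_lt := ht
  c_pos := Nat.one_pos
  c_lt := ht
  row_lt := by omega
  col_lt := hc

/-- The square boundary `squareAt t c₁ …` has `m = 8t` positions. -/
private theorem squareAt_m {N : ℕ} (t c₁ : ℕ) (ht : 2 ≤ t) (hr : 2 * t < N) (hc : c₁ + 2 * t < N) :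
    (squareAt t c₁ ht hr hc).m = 4 * t := by
  unfold RectData.m squareAt; ring

/-- Columns of boundary points of a rectangle lie in `[c₁, c₁ + 2·hw]`. -/
private theorem c₁_le_posCol {N : ℕ} (R : RectData N) (k : ℕ) : R.c₁ ≤ R.posCol k := by
  unfold RectData.posCol; split_ifs <;> omega

/-- Column positions of a rectangle boundary stay within `c₁ + 2·hw`. -/
private theorem posCol_le {N : ℕ} (R : RectData N) (k : ℕ) : R.posCol k ≤ R.c₁ + 2 * R.hw := by
  unfold RectData.posCol; split_ifs <;> omega

/-- The column offset of the `j`-th square: `j(2t+1)`; consecutive offsets differ by more than a side. -/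
theorem offset_lt {N J t : ℕ} (hJ : J * (2 * t + 1) ≤ N) (j : Fin J) : j.val * (2 * t + 1) + 2 * t < N := by
  have h1 : (j.val + 1) * (2 * t + 1) ≤ J * (2 * t + 1) := Nat.mul_le_mul_right _ (by omega)
  have h2 : (j.val + 1) * (2 * t + 1) = j.val * (2 * t + 1) + 2 * t + 1 := by ring
  omega

/-- If `J(2t+1) ≤ N` and `0 < J` then `2t < N`. -/
theorem two_t_lt {N J t : ℕ} (hJ : J * (2 * t + 1) ≤ N) (hJ0 : 0 < J) : 2 * t < N := by
  have := offset_lt hJ ⟨0, hJ0⟩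
  simp at this
  omega

end RowSquares

namespace GridCycles

open RowSquares

/-- **The packing**: for `t ≥ 2` and `J(2t+1) ≤ N`, the boundaries of the squares of side `2t` with top-left corners
`(0, j(2t+1))`, `j < J`, form `J` pairwise disjoint grid cycles of length `8t` in the `N × N` grid. -/
def rowSquares (N J t : ℕ) (ht : 2 ≤ t) (hJ0 : 0 < J) (hJ : J * (2 * t + 1) ≤ N) : GridCycles N J (8 * t) where
  toFun j := ((squareAt t (j.val * (2 * t + 1)) ht (two_t_lt hJ hJ0) (offset_lt hJ j)).gridCycle.cast
    (by rw [squareAt_m]; ring)).toFun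
  injective := by
    intro j j' i i' h
    -- the column of the common point pins the square
    have hc : ((squareAt t (j.val * (2 * t + 1)) ht (two_t_lt hJ hJ0) (offset_lt hJ j)).posCol i.val) =
        ((squareAt t (j'.val * (2 * t + 1)) ht (two_t_lt hJ hJ0) (offset_lt hJ j')).posCol i'.val) :=
      congrArg (fun a => a.2.val) h
    have hjj : j = j' := by
      have l1 : j.val * (2 * t + 1) ≤
          (squareAt t (j.val * (2 * t + 1)) ht (two_t_lt hJ hJ0) (offset_lt hJ j)).posCol i.val :=
        c₁_le_posCol (squareAt t (j.val * (2 * t + 1)) ht (two_t_lt hJ hJ0) (offset_lt hJ j)) i.val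
      have u1 : (squareAt t (j.val * (2 * t + 1)) ht (two_t_lt hJ hJ0) (offset_lt hJ j)).posCol i.val ≤
          j.val * (2 * t + 1) + 2 * t :=
        posCol_le (squareAt t (j.val * (2 * t + 1)) ht (two_t_lt hJ hJ0) (offset_lt hJ j)) i.val
      have l2 : j'.val * (2 * t + 1) ≤
          (squareAt t (j'.val * (2 * t + 1)) ht (two_t_lt hJ hJ0) (offset_lt hJ j')).posCol i'.val :=
        c₁_le_posCol (squareAt t (j'.val * (2 * t + 1)) ht (two_t_lt hJ hJ0) (offset_lt hJ j')) i'.val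
      have u2 : (squareAt t (j'.val * (2 * t + 1)) ht (two_t_lt hJ hJ0) (offset_lt hJ j')).posCol i'.val ≤
          j'.val * (2 * t + 1) + 2 * t :=
        posCol_le (squareAt t (j'.val * (2 * t + 1)) ht (two_t_lt hJ hJ0) (offset_lt hJ j')) i'.val
      apply Fin.ext
      by_contra hne
      rcases Nat.lt_or_gt_of_ne hne with hlt | hlt
      · have h1 : (j.val + 1) * (2 * t + 1) ≤ j'.val * (2 * t + 1) := Nat.mul_le_mul_right _ (by omega)
        have h2 : (j.val + 1) * (2 * t + 1) = j.val * (2 * t + 1) + 2 * t + 1 := by ring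
        omega
      · have h1 : (j'.val + 1) * (2 * t + 1) ≤ j.val * (2 * t + 1) := Nat.mul_le_mul_right _ (by omega)
        have h2 : (j'.val + 1) * (2 * t + 1) = j'.val * (2 * t + 1) + 2 * t + 1 := by ring
        omega
    subst hjj
    exact ⟨rfl, (GridCycle.injective _) h⟩
  adj j i := ((squareAt t (j.val * (2 * t + 1)) ht (two_t_lt hJ hJ0) (offset_lt hJ j)).gridCycle.cast
    (by rw [squareAt_m]; ring)).adj i

end GridCycles




/-- Flattening of a joint pattern `Fin J → Fin n → Bool` to `Fin (J·n) → Bool` (row-major, `finProdFinEquiv`). -/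
def flat {J n : ℕ} (X : Fin J → Fin n → Bool) : Fin (J * n) → Bool :=
  fun k => X (finProdFinEquiv.symm k).1 (finProdFinEquiv.symm k).2

/-- Un-flattening. -/
def unflat {J n : ℕ} (u : Fin (J * n) → Bool) : Fin J → Fin n → Bool :=
  fun j i => u (finProdFinEquiv (j, i))

/-- `flat` is a left inverse of `unflat`. -/
theorem flat_unflat {J n : ℕ} (u : Fin (J * n) → Bool) : flat (unflat u) = u := by
  funext k
  simp only [flat, unflat, Prod.mk.eta, Equiv.apply_symm_apply]

/-- `unflat` is injective. -/
theorem unflat_injective {J n : ℕ} : Function.Injective (unflat (J := J) (n := n)) :=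
  fun u u' h => by rw [← flat_unflat u, ← flat_unflat u', h]


end Summit.QuantumAdvantage.QuantumAdvantage.Theorems
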